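import Literature.Analysis.InnerProduct.IkedaIsospectralNonIsometricExistenceFour
import HarnessLib

/-!
# Ikeda's Lemmas 1.4–1.5 and Proposition 1.9: the sign-pattern counts `|A_q|` are at most `1` (resp. their triple sum at
# most `2`), so `Ψ_{q,3}` takes at most two and `Ψ_{q,4}` at most six values on `Ĩ₀` (Ikeda 1980, §1)

Layer `Literature/Analysis/InnerProduct`, namespace `Literature.Analysis.InnerProduct`; lane `lit-hodgefound`, prover seat
`lit-hodgefound-p06`, generation 46, row g46-#3. THEOREMS only (no definition, no instance, no notation, no named fact).
Companion of `FiveDimensionalIsospectralLensSpaces.lean` (row g44-#4: Proposition 1.7 for `k = 3`,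
`IsIkedaWeights.ikedaPolynomial_fin_three`) and `IkedaIsospectralNonIsometricExistenceFour.lean` (row g46-#2: Proposition
1.6 for `k = 4`, `IsIkedaWeights.ikedaPolynomial_fin_four`): it supplies Lemma 1.4, Lemma 1.5, the converse directions of
Propositions 1.6 and 1.7, and Proposition 1.9 — the counting route by which the source proves Theorem 3.1 (ii)/(iii)
(rows g45-#10 and g46-#2 prove those by explicit witnesses). With this file §1 of Ikeda 1980 is formalised in full.

## Source, verbatim (held text `paper:doi-10-24033-asens-1384`)

A. Ikeda, *On lens spaces which are isospectral but not isometric*, Ann. Sci. ÉNS (4) **13** (1980) 303–315, §1 (p. 306–308):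
"Set (1.6) `J(q, k) = Ψ̃_{q,k}(I₀(q, k))`. … Let `p₁, p₂, p₃` be integers with `(p₁, p₂, p₃) ∈ Ĩ₀(q, 3)` and `s₁, s₂, s₃, s₄`
be integers with `(s₁, s₂, s₃, s₄) ∈ Ĩ₀(q, 4)`. We define the sets `A_q(p₁, p₂, p₃)` and `A_q(s₁, s₂, s₃, s₄)` by
`A_q(p₁, p₂, p₃) = {(ξ, μ) : p₁ + ξp₂ + μp₃ ≡ 0 (mod q), ξ, μ ∈ {−1, 1}}`, `A_q(s₁, s₂, s₃, s₄) = {(ξ, μ, ν) :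
s₁ + ξs₂ + μs₃ + νs₄ ≡ 0 (mod q), ξ, μ, ν ∈ {−1, 1}}`, respectively. **Lemma 1.4.** For any element `(p₁, p₂, p₃) ∈ Ĩ₀(q, 3)`,
we have `|A_q(p₁, p₂, p₃)| ≤ 1`. *Proof.* If one of the integers `p₁ ± p₂ ± p₃` is congruent to zero (mod `q`), we may assume
`p₁ + p₂ + p₃ ≡ 0 (mod q)`, if necessary, changing the sign of `p₂` or `p₃`. Then `(p₁ + p₂ + p₃) − (p₁ + p₂ − p₃) = 2p₃
(mod q)`. Hence, `p₁ + p₂ − p₃ ≢ 0 (mod q)`. In the same way, we can see the integers `p₁ − p₂ + p₃` and `p₁ − p₂ − p₃` are not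
congruent to zero (mod `q`). Hence we have proved the Lemma. Q.E.D. **Lemma 1.5.** For any element `(p₁, p₂, p₃, p₄) ∈
Ĩ₀(q, 4)`, we have (i) `|A_q(p₁, p₂, p₃, p₄)| ≤ 1`; (ii) `Σ_{1≤l₁<l₂<l₃≤4}|A_q(p_{l₁}, p_{l₂}, p_{l₃})| ≤ 2`. *Proof.* (i) can be
obtained in the same way as Lemma 1.4. We shall prove (ii). Suppose `Σ|A_q(p_{l₁},p_{l₂},p_{l₃})| ≥ 3`. Then we may assume
`|A_q(p₁,p₂,p₃)| = |A_q(p₁,p₂,p₄)| = |A_q(p₁,p₃,p₄)| = 1`. We may also assume, changing the sign of `p₂` or `p₃` if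
necessary, (1.7) `p₁ + p₂ + p₃ ≡ 0 (mod q)`. Since `p₃ ≢ ±p₄ (mod q)`, we have `p₁ − p₂ + p₄ ≡ 0 (mod q)` or `p₁ − p₂ − p₄ ≡
0 (mod q)`. In the same reason as above, we may assume (1.8) `p₁ − p₂ + p₄ ≡ 0 (mod q)`. Since `p₂ ≢ ±p₄`, we have (1.9)
`p₁ − p₃ + p₄ ≡ 0 (mod q)`, or (1.9′) `p₁ − p₃ − p₄ ≡ 0 (mod q)`. From (1.8) and (1.9), we have `p₂ ≡ p₃ (mod q)`, which is a
contradiction. On the other hand, from (1.7), (1.8) and (1.9′), we have `3p₁ ≡ 0 (mod q)`. Since `Ĩ₀(3, 4)` is empty, we have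
a contradiction. Thus we have proved the Lemma. Q.E.D. … **Proposition 1.6.** … `Ψ_{q,4}((p₁,p₂,p₃,p₄)) = Ψ_{q,4}((s₁,s₂,s₃,s₄))`
if and only if (i) … and (ii) …. **Proposition 1.7.** … `Ψ_{q,3}((p₁,p₂,p₃)) = Ψ_{q,3}((s₁,s₂,s₃))` if and only if
`|A_q(p₁,p₂,p₃)| = |A_q(s₁,s₂,s₃)|`. From Lemma 1.4, 1.5 and Proposition 1.6, 1.7, we have: **Proposition 1.9.** (i) let `q` be a
prime not less than 11, then we have `|J(q, 3)| ≤ 2`; (ii) let `q` be a prime not less than 13 then we have `|J(q, 4)| ≤ 6`."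

## What is proved (the indicator counts written out as sums of four, eight, sixteen indicators, as in rows g44-#4 / g46-#2)

* `signPatternCount_three_eq_zero_or_one` (the mechanism: for `a, b, c ≢ 0` at most one of `a ± b ± c` vanishes),
  **`IsIkedaWeights.signPatternCount_three_eq_zero_or_one`** (LEMMA 1.4), **`IsIkedaWeights.signPatternCount_four_eq_zero_or_one`**
  (LEMMA 1.5 (i): the eight patterns split as those of `(p₁ + p₂, p₃, p₄)` and of `(p₁ − p₂, p₃, p₄)`; one of each kind cannot
  both vanish), **`IsIkedaWeights.triplePatternCount_four_le_two`** (LEMMA 1.5 (ii): the count is `0`, `1` or `2`; the source's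
  (1.7)–(1.9′) argument, `false_of_three_patterns_t5`, applied with the weight common to the three triples as centre — any three
  of the four triples share exactly one weight — and "`Ĩ₀(3, 4)` is empty" as a `decide` over `ℤ/3`).
* **`IsIkedaWeights.ikedaPolynomial_fin_three_eq_iff`** (PROPOSITION 1.7 ⟺, coefficient of `z³`),
  **`IsIkedaWeights.ikedaPolynomial_fin_four_eq_iff`** (PROPOSITION 1.6 ⟺, coefficients of `z⁵`, `z⁴`).
* `IsIkedaWeights.ikedaPolynomial_fin_three_eq_or`, **`ncard_ikedaPolynomial_fin_three_le_two`** (PROPOSITION 1.9 (i): the set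
  of values of `Ψ_{q,3}` on `Ĩ₀(q,3)` has `ncard ≤ 2`), **`ncard_ikedaPolynomial_fin_four_le_six`** (PROPOSITION 1.9 (ii):
  `ncard ≤ 6`), for every odd prime `q` (the source's `q ≥ 11`, `q ≥ 13` only make `I₀(q, k)` non-empty).

## References

* [Ikeda1980] A. Ikeda, *On lens spaces which are isospectral but not isometric*, Ann. Sci. ÉNS (4) 13 (1980) 303–315, §1:
  (1.6), Lemma 1.4, Lemma 1.5, Proposition 1.6, Proposition 1.7, Proposition 1.9.
-/

noncomputable section

open Finset Polynomial.Chebyshev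

namespace Literature.Analysis.InnerProduct

open _root_.Real

section LemmaOneFour
open Polynomial

variable {q : ℕ} [hq : Fact q.Prime]

/-- For an odd prime `q`: `q ∣ 2x ⇒ q ∣ x`. [folklore] -/
private theorem dvd_of_dvd_two_mul_t5 (hq2 : q ≠ 2) {x : ℤ} (h : (q : ℤ) ∣ 2 * x) : (q : ℤ) ∣ x := by
  rcases (Nat.prime_iff_prime_int.mp hq.out).dvd_or_dvd h with h2 | hx
  · exfalso
    have : q ∣ 2 := by exact_mod_cast h2
    exact hq2 ((Nat.prime_dvd_prime_iff_eq hq.out Nat.prime_two).mp this)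
  · exact hx

/-- The mechanism of Lemma 1.4: for integers `a, b, c ≢ 0 (mod q)` (`q` an odd prime) at most one of the four sign patterns
`a ± b ± c` vanishes mod `q` — two patterns differing in one sign differ by `2b` or `2c`, complementary patterns add up to
`2a`. [cite: Ikeda1980, Lemma 1.4 (proof)] -/
theorem signPatternCount_three_eq_zero_or_one (hq2 : q ≠ 2) {a b c : ℤ} (ha : ¬(q : ℤ) ∣ a) (hb : ¬(q : ℤ) ∣ b)
    (hc : ¬(q : ℤ) ∣ c) :
    (if (q : ℤ) ∣ a + b + c then (1 : ℝ) else 0) + (if (q : ℤ) ∣ a + b - c then (1 : ℝ) else 0) + (if (q : ℤ) ∣ a - b + c then (1 : ℝ) else 0) + (if (q : ℤ) ∣ a - b - c then (1 : ℝ) else 0) = 0 ∨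
      (if (q : ℤ) ∣ a + b + c then (1 : ℝ) else 0) + (if (q : ℤ) ∣ a + b - c then (1 : ℝ) else 0) + (if (q : ℤ) ∣ a - b + c then (1 : ℝ) else 0) + (if (q : ℤ) ∣ a - b - c then (1 : ℝ) else 0) = 1 := by
  have two : ∀ {x : ℤ}, (q : ℤ) ∣ 2 * x → (q : ℤ) ∣ x := fun h ↦ dvd_of_dvd_two_mul_t5 hq2 h
  have x12 : (q : ℤ) ∣ a + b + c → (q : ℤ) ∣ a + b - c → False := fun h h' ↦
    hc (two (by have h2 := dvd_sub h h'; rwa [show (a + b + c) - (a + b - c) = 2 * c by ring] at h2))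
  have x13 : (q : ℤ) ∣ a + b + c → (q : ℤ) ∣ a - b + c → False := fun h h' ↦
    hb (two (by have h2 := dvd_sub h h'; rwa [show (a + b + c) - (a - b + c) = 2 * b by ring] at h2))
  have x14 : (q : ℤ) ∣ a + b + c → (q : ℤ) ∣ a - b - c → False := fun h h' ↦
    ha (two (by have h2 := dvd_add h h'; rwa [show (a + b + c) + (a - b - c) = 2 * a by ring] at h2))
  have x23 : (q : ℤ) ∣ a + b - c → (q : ℤ) ∣ a - b + c → False := fun h h' ↦
    ha (two (by have h2 := dvd_add h h'; rwa [show (a + b - c) + (a - b + c) = 2 * a by ring] at h2))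
  have x24 : (q : ℤ) ∣ a + b - c → (q : ℤ) ∣ a - b - c → False := fun h h' ↦
    hb (two (by have h2 := dvd_sub h h'; rwa [show (a + b - c) - (a - b - c) = 2 * b by ring] at h2))
  have x34 : (q : ℤ) ∣ a - b + c → (q : ℤ) ∣ a - b - c → False := fun h h' ↦
    hc (two (by have h2 := dvd_sub h h'; rwa [show (a - b + c) - (a - b - c) = 2 * c by ring] at h2))
  split_ifs <;> norm_num <;>
    first | exact x12 ‹_› ‹_› | exact x13 ‹_› ‹_› | exact x14 ‹_› ‹_› | exact x23 ‹_› ‹_› | exact x24 ‹_› ‹_› | exact x34 ‹_› ‹_›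

/-- **LEMMA 1.4 (Ikeda 1980): for `(p₁, p₂, p₃) ∈ Ĩ₀(q, 3)` (`q` an odd prime), `|A_q(p₁, p₂, p₃)| ≤ 1`** — at most one of
the four sign patterns `p₁ ± p₂ ± p₃` vanishes mod `q`, i.e. the indicator count is `0` or `1` ("If one of the integers
`p₁ ± p₂ ± p₃` is congruent to zero … `(p₁+p₂+p₃) − (p₁+p₂−p₃) = 2p₃` … hence `p₁+p₂−p₃ ≢ 0`"). [cite: Ikeda1980, Lemma 1.4] -/
theorem IsIkedaWeights.signPatternCount_three_eq_zero_or_one (hq2 : q ≠ 2) {ω : Fin 3 → ℤ} (hω : IsIkedaWeights q ω) :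
    (if (q : ℤ) ∣ ω 0 + ω 1 + ω 2 then (1 : ℝ) else 0) + (if (q : ℤ) ∣ ω 0 + ω 1 - ω 2 then (1 : ℝ) else 0) + (if (q : ℤ) ∣ ω 0 - ω 1 + ω 2 then (1 : ℝ) else 0) + (if (q : ℤ) ∣ ω 0 - ω 1 - ω 2 then (1 : ℝ) else 0) = 0 ∨
      (if (q : ℤ) ∣ ω 0 + ω 1 + ω 2 then (1 : ℝ) else 0) + (if (q : ℤ) ∣ ω 0 + ω 1 - ω 2 then (1 : ℝ) else 0) + (if (q : ℤ) ∣ ω 0 - ω 1 + ω 2 then (1 : ℝ) else 0) + (if (q : ℤ) ∣ ω 0 - ω 1 - ω 2 then (1 : ℝ) else 0) = 1 :=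
  Literature.Analysis.InnerProduct.signPatternCount_three_eq_zero_or_one hq2 (hω.not_dvd 0) (hω.not_dvd 1) (hω.not_dvd 2)

/-- **LEMMA 1.5 (i) (Ikeda 1980): for `(p₁, p₂, p₃, p₄) ∈ Ĩ₀(q, 4)` (`q` an odd prime), `|A_q(p₁, p₂, p₃, p₄)| ≤ 1`** — at
most one of the eight sign patterns `p₁ ± p₂ ± p₃ ± p₄` vanishes mod `q` ("(i) can be obtained in the same way as Lemma 1.4":
the patterns `p₁ + p₂ ± p₃ ± p₄` are those of the triple `(p₁ + p₂, p₃, p₄)`, the patterns `p₁ − p₂ ± p₃ ± p₄` those of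
`(p₁ − p₂, p₃, p₄)` — at most one of each kind vanishes — and a pattern of the first kind and one of the second kind differ
by `2p₂`, by `2(p₂ ± pⱼ)`, or add up to `2p₁`). [cite: Ikeda1980, Lemma 1.5 (i)] -/
theorem IsIkedaWeights.signPatternCount_four_eq_zero_or_one (hq2 : q ≠ 2) {ω : Fin 4 → ℤ} (hω : IsIkedaWeights q ω) :
    (if (q : ℤ) ∣ ω 0 + ω 1 + ω 2 + ω 3 then (1 : ℝ) else 0) + (if (q : ℤ) ∣ ω 0 + ω 1 + ω 2 - ω 3 then (1 : ℝ) else 0) +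
      (if (q : ℤ) ∣ ω 0 + ω 1 - ω 2 + ω 3 then (1 : ℝ) else 0) + (if (q : ℤ) ∣ ω 0 + ω 1 - ω 2 - ω 3 then (1 : ℝ) else 0) +
      (if (q : ℤ) ∣ ω 0 - ω 1 + ω 2 + ω 3 then (1 : ℝ) else 0) + (if (q : ℤ) ∣ ω 0 - ω 1 + ω 2 - ω 3 then (1 : ℝ) else 0) +
      (if (q : ℤ) ∣ ω 0 - ω 1 - ω 2 + ω 3 then (1 : ℝ) else 0) + (if (q : ℤ) ∣ ω 0 - ω 1 - ω 2 - ω 3 then (1 : ℝ) else 0) = 0 ∨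
      (if (q : ℤ) ∣ ω 0 + ω 1 + ω 2 + ω 3 then (1 : ℝ) else 0) + (if (q : ℤ) ∣ ω 0 + ω 1 + ω 2 - ω 3 then (1 : ℝ) else 0) +
      (if (q : ℤ) ∣ ω 0 + ω 1 - ω 2 + ω 3 then (1 : ℝ) else 0) + (if (q : ℤ) ∣ ω 0 + ω 1 - ω 2 - ω 3 then (1 : ℝ) else 0) +
      (if (q : ℤ) ∣ ω 0 - ω 1 + ω 2 + ω 3 then (1 : ℝ) else 0) + (if (q : ℤ) ∣ ω 0 - ω 1 + ω 2 - ω 3 then (1 : ℝ) else 0) +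
      (if (q : ℤ) ∣ ω 0 - ω 1 - ω 2 + ω 3 then (1 : ℝ) else 0) + (if (q : ℤ) ∣ ω 0 - ω 1 - ω 2 - ω 3 then (1 : ℝ) else 0) = 1 := by
  have hn : ∀ i, ¬(q : ℤ) ∣ ω i := hω.not_dvd
  have hs : ∀ i j, i ≠ j → ¬(q : ℤ) ∣ ω i - ω j := hω.not_dvd_sub
  have ha : ∀ i j, i ≠ j → ¬(q : ℤ) ∣ ω i + ω j := hω.not_dvd_add
  have two : ∀ {x : ℤ}, (q : ℤ) ∣ 2 * x → (q : ℤ) ∣ x := fun h ↦ dvd_of_dvd_two_mul_t5 hq2 h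
  -- the two kinds of patterns
  have hp := Literature.Analysis.InnerProduct.signPatternCount_three_eq_zero_or_one hq2 (ha 0 1 (by decide)) (hn 2) (hn 3)
  have hm := Literature.Analysis.InnerProduct.signPatternCount_three_eq_zero_or_one hq2 (hs 0 1 (by decide)) (hn 2) (hn 3)
  -- a pattern of each kind cannot both vanish
  have hx : ¬ ((if (q : ℤ) ∣ ω 0 + ω 1 + ω 2 + ω 3 then (1 : ℝ) else 0) + (if (q : ℤ) ∣ ω 0 + ω 1 + ω 2 - ω 3 then (1 : ℝ) else 0) + (if (q : ℤ) ∣ ω 0 + ω 1 - ω 2 + ω 3 then (1 : ℝ) else 0) + (if (q : ℤ) ∣ ω 0 + ω 1 - ω 2 - ω 3 then (1 : ℝ) else 0) = 1 ∧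
      (if (q : ℤ) ∣ ω 0 - ω 1 + ω 2 + ω 3 then (1 : ℝ) else 0) + (if (q : ℤ) ∣ ω 0 - ω 1 + ω 2 - ω 3 then (1 : ℝ) else 0) + (if (q : ℤ) ∣ ω 0 - ω 1 - ω 2 + ω 3 then (1 : ℝ) else 0) + (if (q : ℤ) ∣ ω 0 - ω 1 - ω 2 - ω 3 then (1 : ℝ) else 0) = 1) := by
    rintro ⟨h1, h2⟩
    have y11 : (q : ℤ) ∣ ω 0 + ω 1 + ω 2 + ω 3 → (q : ℤ) ∣ ω 0 - ω 1 + ω 2 + ω 3 → False := fun h h' ↦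
      hn 1 (two (by have h2 := dvd_sub h h'; rwa [show (ω 0 + ω 1 + ω 2 + ω 3) - (ω 0 - ω 1 + ω 2 + ω 3) = 2 * (ω 1) by ring] at h2))
    have y12 : (q : ℤ) ∣ ω 0 + ω 1 + ω 2 + ω 3 → (q : ℤ) ∣ ω 0 - ω 1 + ω 2 - ω 3 → False := fun h h' ↦
      ha 1 3 (by decide) (two (by have h2 := dvd_sub h h'; rwa [show (ω 0 + ω 1 + ω 2 + ω 3) - (ω 0 - ω 1 + ω 2 - ω 3) = 2 * (ω 1 + ω 3) by ring] at h2))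
    have y13 : (q : ℤ) ∣ ω 0 + ω 1 + ω 2 + ω 3 → (q : ℤ) ∣ ω 0 - ω 1 - ω 2 + ω 3 → False := fun h h' ↦
      ha 1 2 (by decide) (two (by have h2 := dvd_sub h h'; rwa [show (ω 0 + ω 1 + ω 2 + ω 3) - (ω 0 - ω 1 - ω 2 + ω 3) = 2 * (ω 1 + ω 2) by ring] at h2))
    have y14 : (q : ℤ) ∣ ω 0 + ω 1 + ω 2 + ω 3 → (q : ℤ) ∣ ω 0 - ω 1 - ω 2 - ω 3 → False := fun h h' ↦
      hn 0 (two (by have h2 := dvd_add h h'; rwa [show (ω 0 + ω 1 + ω 2 + ω 3) + (ω 0 - ω 1 - ω 2 - ω 3) = 2 * (ω 0) by ring] at h2))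
    have y21 : (q : ℤ) ∣ ω 0 + ω 1 + ω 2 - ω 3 → (q : ℤ) ∣ ω 0 - ω 1 + ω 2 + ω 3 → False := fun h h' ↦
      hs 1 3 (by decide) (two (by have h2 := dvd_sub h h'; rwa [show (ω 0 + ω 1 + ω 2 - ω 3) - (ω 0 - ω 1 + ω 2 + ω 3) = 2 * (ω 1 - ω 3) by ring] at h2))
    have y22 : (q : ℤ) ∣ ω 0 + ω 1 + ω 2 - ω 3 → (q : ℤ) ∣ ω 0 - ω 1 + ω 2 - ω 3 → False := fun h h' ↦
      hn 1 (two (by have h2 := dvd_sub h h'; rwa [show (ω 0 + ω 1 + ω 2 - ω 3) - (ω 0 - ω 1 + ω 2 - ω 3) = 2 * (ω 1) by ring] at h2))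
    have y23 : (q : ℤ) ∣ ω 0 + ω 1 + ω 2 - ω 3 → (q : ℤ) ∣ ω 0 - ω 1 - ω 2 + ω 3 → False := fun h h' ↦
      hn 0 (two (by have h2 := dvd_add h h'; rwa [show (ω 0 + ω 1 + ω 2 - ω 3) + (ω 0 - ω 1 - ω 2 + ω 3) = 2 * (ω 0) by ring] at h2))
    have y24 : (q : ℤ) ∣ ω 0 + ω 1 + ω 2 - ω 3 → (q : ℤ) ∣ ω 0 - ω 1 - ω 2 - ω 3 → False := fun h h' ↦
      ha 1 2 (by decide) (two (by have h2 := dvd_sub h h'; rwa [show (ω 0 + ω 1 + ω 2 - ω 3) - (ω 0 - ω 1 - ω 2 - ω 3) = 2 * (ω 1 + ω 2) by ring] at h2))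
    have y31 : (q : ℤ) ∣ ω 0 + ω 1 - ω 2 + ω 3 → (q : ℤ) ∣ ω 0 - ω 1 + ω 2 + ω 3 → False := fun h h' ↦
      hs 1 2 (by decide) (two (by have h2 := dvd_sub h h'; rwa [show (ω 0 + ω 1 - ω 2 + ω 3) - (ω 0 - ω 1 + ω 2 + ω 3) = 2 * (ω 1 - ω 2) by ring] at h2))
    have y32 : (q : ℤ) ∣ ω 0 + ω 1 - ω 2 + ω 3 → (q : ℤ) ∣ ω 0 - ω 1 + ω 2 - ω 3 → False := fun h h' ↦
      hn 0 (two (by have h2 := dvd_add h h'; rwa [show (ω 0 + ω 1 - ω 2 + ω 3) + (ω 0 - ω 1 + ω 2 - ω 3) = 2 * (ω 0) by ring] at h2))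
    have y33 : (q : ℤ) ∣ ω 0 + ω 1 - ω 2 + ω 3 → (q : ℤ) ∣ ω 0 - ω 1 - ω 2 + ω 3 → False := fun h h' ↦
      hn 1 (two (by have h2 := dvd_sub h h'; rwa [show (ω 0 + ω 1 - ω 2 + ω 3) - (ω 0 - ω 1 - ω 2 + ω 3) = 2 * (ω 1) by ring] at h2))
    have y34 : (q : ℤ) ∣ ω 0 + ω 1 - ω 2 + ω 3 → (q : ℤ) ∣ ω 0 - ω 1 - ω 2 - ω 3 → False := fun h h' ↦
      ha 1 3 (by decide) (two (by have h2 := dvd_sub h h'; rwa [show (ω 0 + ω 1 - ω 2 + ω 3) - (ω 0 - ω 1 - ω 2 - ω 3) = 2 * (ω 1 + ω 3) by ring] at h2))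
    have y41 : (q : ℤ) ∣ ω 0 + ω 1 - ω 2 - ω 3 → (q : ℤ) ∣ ω 0 - ω 1 + ω 2 + ω 3 → False := fun h h' ↦
      hn 0 (two (by have h2 := dvd_add h h'; rwa [show (ω 0 + ω 1 - ω 2 - ω 3) + (ω 0 - ω 1 + ω 2 + ω 3) = 2 * (ω 0) by ring] at h2))
    have y42 : (q : ℤ) ∣ ω 0 + ω 1 - ω 2 - ω 3 → (q : ℤ) ∣ ω 0 - ω 1 + ω 2 - ω 3 → False := fun h h' ↦
      hs 1 2 (by decide) (two (by have h2 := dvd_sub h h'; rwa [show (ω 0 + ω 1 - ω 2 - ω 3) - (ω 0 - ω 1 + ω 2 - ω 3) = 2 * (ω 1 - ω 2) by ring] at h2))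
    have y43 : (q : ℤ) ∣ ω 0 + ω 1 - ω 2 - ω 3 → (q : ℤ) ∣ ω 0 - ω 1 - ω 2 + ω 3 → False := fun h h' ↦
      hs 1 3 (by decide) (two (by have h2 := dvd_sub h h'; rwa [show (ω 0 + ω 1 - ω 2 - ω 3) - (ω 0 - ω 1 - ω 2 + ω 3) = 2 * (ω 1 - ω 3) by ring] at h2))
    have y44 : (q : ℤ) ∣ ω 0 + ω 1 - ω 2 - ω 3 → (q : ℤ) ∣ ω 0 - ω 1 - ω 2 - ω 3 → False := fun h h' ↦
      hn 1 (two (by have h2 := dvd_sub h h'; rwa [show (ω 0 + ω 1 - ω 2 - ω 3) - (ω 0 - ω 1 - ω 2 - ω 3) = 2 * (ω 1) by ring] at h2))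
    split_ifs at h1 <;> norm_num at h1 <;> split_ifs at h2 <;> norm_num at h2 <;>
      first | exact y11 ‹_› ‹_› | exact y12 ‹_› ‹_› | exact y13 ‹_› ‹_› | exact y14 ‹_› ‹_› | exact y21 ‹_› ‹_› | exact y22 ‹_› ‹_› | exact y23 ‹_› ‹_› | exact y24 ‹_› ‹_› | exact y31 ‹_› ‹_› | exact y32 ‹_› ‹_› | exact y33 ‹_› ‹_› | exact y34 ‹_› ‹_› | exact y41 ‹_› ‹_› | exact y42 ‹_› ‹_› | exact y43 ‹_› ‹_› | exact y44 ‹_› ‹_›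
  have hsum : (if (q : ℤ) ∣ ω 0 + ω 1 + ω 2 + ω 3 then (1 : ℝ) else 0) + (if (q : ℤ) ∣ ω 0 + ω 1 + ω 2 - ω 3 then (1 : ℝ) else 0) +
      (if (q : ℤ) ∣ ω 0 + ω 1 - ω 2 + ω 3 then (1 : ℝ) else 0) + (if (q : ℤ) ∣ ω 0 + ω 1 - ω 2 - ω 3 then (1 : ℝ) else 0) +
      (if (q : ℤ) ∣ ω 0 - ω 1 + ω 2 + ω 3 then (1 : ℝ) else 0) + (if (q : ℤ) ∣ ω 0 - ω 1 + ω 2 - ω 3 then (1 : ℝ) else 0) +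
      (if (q : ℤ) ∣ ω 0 - ω 1 - ω 2 + ω 3 then (1 : ℝ) else 0) + (if (q : ℤ) ∣ ω 0 - ω 1 - ω 2 - ω 3 then (1 : ℝ) else 0) =
      ((if (q : ℤ) ∣ ω 0 + ω 1 + ω 2 + ω 3 then (1 : ℝ) else 0) + (if (q : ℤ) ∣ ω 0 + ω 1 + ω 2 - ω 3 then (1 : ℝ) else 0) + (if (q : ℤ) ∣ ω 0 + ω 1 - ω 2 + ω 3 then (1 : ℝ) else 0) + (if (q : ℤ) ∣ ω 0 + ω 1 - ω 2 - ω 3 then (1 : ℝ) else 0)) +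
      ((if (q : ℤ) ∣ ω 0 - ω 1 + ω 2 + ω 3 then (1 : ℝ) else 0) + (if (q : ℤ) ∣ ω 0 - ω 1 + ω 2 - ω 3 then (1 : ℝ) else 0) + (if (q : ℤ) ∣ ω 0 - ω 1 - ω 2 + ω 3 then (1 : ℝ) else 0) + (if (q : ℤ) ∣ ω 0 - ω 1 - ω 2 - ω 3 then (1 : ℝ) else 0)) := by ring
  rw [hsum]
  rcases hp with hp | hp <;> rcases hm with hm | hm
  · left; rw [hp, hm]; norm_num
  · right; rw [hp, hm]; norm_num
  · right; rw [hp, hm]; norm_num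
  · exact absurd ⟨hp, hm⟩ hx

/-- **PROPOSITION 1.7 AS AN EQUIVALENCE: for `ω, ω' ∈ Ĩ₀(q, 3)`, `Ψ_{q,3}(ω) = Ψ_{q,3}(ω')` if and only if
`|A_q(ω)| = |A_q(ω')|`** (the coefficient of `z³` in `Ψ_{q,3}` is `20 − 2q|A_q|`). [cite: Ikeda1980, Proposition 1.7] -/
theorem IsIkedaWeights.ikedaPolynomial_fin_three_eq_iff {ω ω' : Fin 3 → ℤ} (hω : IsIkedaWeights q ω)
    (hω' : IsIkedaWeights q ω') :
    ikedaPolynomial q ω = ikedaPolynomial q ω' ↔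
      ((if (q : ℤ) ∣ ω 0 + ω 1 + ω 2 then (1 : ℝ) else 0) + (if (q : ℤ) ∣ ω 0 + ω 1 - ω 2 then (1 : ℝ) else 0) + (if (q : ℤ) ∣ ω 0 - ω 1 + ω 2 then (1 : ℝ) else 0) + (if (q : ℤ) ∣ ω 0 - ω 1 - ω 2 then (1 : ℝ) else 0) : ℝ) =
        ((if (q : ℤ) ∣ ω' 0 + ω' 1 + ω' 2 then (1 : ℝ) else 0) + (if (q : ℤ) ∣ ω' 0 + ω' 1 - ω' 2 then (1 : ℝ) else 0) + (if (q : ℤ) ∣ ω' 0 - ω' 1 + ω' 2 then (1 : ℝ) else 0) + (if (q : ℤ) ∣ ω' 0 - ω' 1 - ω' 2 then (1 : ℝ) else 0) : ℝ) := by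
  refine ⟨fun h ↦ ?_, hω.ikedaPolynomial_fin_three_eq hω'⟩
  have hq0 : (q : ℝ) ≠ 0 := Nat.cast_ne_zero.mpr hq.out.ne_zero
  have hc := congrArg (fun P : ℝ[X] ↦ P.coeff 3) h
  simp only [hω.ikedaPolynomial_fin_three, hω'.ikedaPolynomial_fin_three, Polynomial.coeff_add, Polynomial.coeff_C_mul,
    Polynomial.coeff_X_pow, Polynomial.coeff_X, Polynomial.coeff_one, Nat.reduceEqDiff, reduceIte, mul_one, mul_zero,
    add_zero, zero_add, sub_right_inj] at hc
  exact mul_left_cancel₀ hq0 (by linear_combination hc / 2)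

/-- **PROPOSITION 1.9 (i) (Ikeda 1980): `|J(q, 3)| ≤ 2`** — on `Ĩ₀(q, 3)` the polynomial `Ψ_{q,3}` takes at most the two values
`(q−1)(z⁶+1) + 6(z⁵+z) + (3q−15)(z⁴+z²) + (20 − 2qt)z³`, `t ∈ {0, 1}` (Lemma 1.4 with Proposition 1.7). [cite: Ikeda1980,
Proposition 1.9 (i), Lemma 1.4, Proposition 1.7] -/
theorem IsIkedaWeights.ikedaPolynomial_fin_three_eq_or (hq2 : q ≠ 2) {ω : Fin 3 → ℤ} (hω : IsIkedaWeights q ω) :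
    ikedaPolynomial q ω = Polynomial.C ((q : ℝ) - 1) * (X ^ 6 + 1) + Polynomial.C 6 * (X ^ 5 + X) +
        Polynomial.C (3 * (q : ℝ) - 15) * (X ^ 4 + X ^ 2) + Polynomial.C 20 * X ^ 3 ∨
      ikedaPolynomial q ω = Polynomial.C ((q : ℝ) - 1) * (X ^ 6 + 1) + Polynomial.C 6 * (X ^ 5 + X) +
        Polynomial.C (3 * (q : ℝ) - 15) * (X ^ 4 + X ^ 2) + Polynomial.C (20 - 2 * (q : ℝ)) * X ^ 3 := by
  rcases hω.signPatternCount_three_eq_zero_or_one hq2 with h | h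
  · left; rw [hω.ikedaPolynomial_fin_three, h, mul_zero, sub_zero]
  · right; rw [hω.ikedaPolynomial_fin_three, h, mul_one]

/-- **PROPOSITION 1.9 (i), cardinality form: `|J(q, 3)| ≤ 2`** — the set `J(q, 3) = Ψ̃_{q,3}(𝓛₀(q, 3))` of values of `Ψ_{q,3}`
on `Ĩ₀(q, 3)` has at most two elements (`q` an odd prime). [cite: Ikeda1980, Proposition 1.9 (i) and (1.6)] -/
theorem ncard_ikedaPolynomial_fin_three_le_two (hq2 : q ≠ 2) :
    {P : ℝ[X] | ∃ ω : Fin 3 → ℤ, IsIkedaWeights q ω ∧ ikedaPolynomial q ω = P}.ncard ≤ 2 := by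
  have hsub : {P : ℝ[X] | ∃ ω : Fin 3 → ℤ, IsIkedaWeights q ω ∧ ikedaPolynomial q ω = P} ⊆
      ({Polynomial.C ((q : ℝ) - 1) * (X ^ 6 + 1) + Polynomial.C 6 * (X ^ 5 + X) +
        Polynomial.C (3 * (q : ℝ) - 15) * (X ^ 4 + X ^ 2) + Polynomial.C 20 * X ^ 3,
        Polynomial.C ((q : ℝ) - 1) * (X ^ 6 + 1) + Polynomial.C 6 * (X ^ 5 + X) +
        Polynomial.C (3 * (q : ℝ) - 15) * (X ^ 4 + X ^ 2) + Polynomial.C (20 - 2 * (q : ℝ)) * X ^ 3} : Set ℝ[X]) := by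
    rintro P ⟨ω, hω, rfl⟩
    rcases hω.ikedaPolynomial_fin_three_eq_or hq2 with h | h
    · rw [h]; exact Set.mem_insert _ _
    · rw [h]; exact Set.mem_insert_of_mem _ (Set.mem_singleton _)
  refine (Set.ncard_le_ncard hsub (Set.toFinite _)).trans ?_
  exact (Set.ncard_insert_le _ _).trans (by rw [Set.ncard_singleton])

/-! ### Lemma 1.5 (ii): at most two of the four triples of `(p₁, p₂, p₃, p₄) ∈ Ĩ₀(q, 4)` have a vanishing sign pattern -/

/-- "`Ĩ₀(3, 4)` is empty": two nonzero residues mod `3` are congruent or opposite. [cite: Ikeda1980, Lemma 1.5 (proof)] -/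
private theorem zmod_three_t5 : ∀ Y Z : ZMod 3, Y ≠ 0 → Z ≠ 0 → Y - Z ≠ 0 → Y + Z ≠ 0 → False := by decide

omit hq in
/-- Transport of divisibility along a ring identity. [folklore] -/
private theorem dvd_congr_t5 {E E' : ℤ} (h : (q : ℤ) ∣ E') (he : E' = E) : (q : ℤ) ∣ E := he ▸ h

omit hq in
/-- A vanishing sign pattern from a nonzero indicator count: `|A_q(x, y, z)| ≠ 0 ⇒ q ∣ x + βy + γz` for some signs `β, γ`.
[cite: Ikeda1980, Lemma 1.5 (proof, (1.7))] -/
private theorem exists_signs_of_count_ne_zero_t5 {x y z : ℤ}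
    (h : (if (q : ℤ) ∣ x + y + z then (1 : ℝ) else 0) + (if (q : ℤ) ∣ x + y - z then (1 : ℝ) else 0) + (if (q : ℤ) ∣ x - y + z then (1 : ℝ) else 0) + (if (q : ℤ) ∣ x - y - z then (1 : ℝ) else 0) ≠ 0) :
    ∃ β γ : ℤ, (β = 1 ∨ β = -1) ∧ (γ = 1 ∨ γ = -1) ∧ (q : ℤ) ∣ x + β * y + γ * z := by
  by_cases h1 : (q : ℤ) ∣ x + y + z
  · exact ⟨1, 1, Or.inl rfl, Or.inl rfl, by rwa [one_mul, one_mul]⟩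
  by_cases h2 : (q : ℤ) ∣ x + y - z
  · exact ⟨1, -1, Or.inl rfl, Or.inr rfl, by rwa [one_mul, neg_one_mul, ← sub_eq_add_neg]⟩
  by_cases h3 : (q : ℤ) ∣ x - y + z
  · exact ⟨-1, 1, Or.inr rfl, Or.inl rfl, by rwa [one_mul, neg_one_mul, ← sub_eq_add_neg]⟩
  by_cases h4 : (q : ℤ) ∣ x - y - z
  · exact ⟨-1, -1, Or.inr rfl, Or.inr rfl, by rwa [neg_one_mul, neg_one_mul, ← sub_eq_add_neg, ← sub_eq_add_neg]⟩
  exact absurd (by rw [if_neg h1, if_neg h2, if_neg h3, if_neg h4]; norm_num) h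

omit hq in
/-- Re-centring a vanishing pattern on its second entry: `q ∣ x + βy + γz ⇒ q ∣ y + βx + (βγ)z`. [folklore] -/
private theorem recenter₂_t5 {x y z : ℤ}
    (h : ∃ β γ : ℤ, (β = 1 ∨ β = -1) ∧ (γ = 1 ∨ γ = -1) ∧ (q : ℤ) ∣ x + β * y + γ * z) :
    ∃ β γ : ℤ, (β = 1 ∨ β = -1) ∧ (γ = 1 ∨ γ = -1) ∧ (q : ℤ) ∣ y + β * x + γ * z := by
  obtain ⟨β, γ, hβ, hγ, hd⟩ := h
  refine ⟨β, β * γ, hβ, ?_, ?_⟩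
  · rcases hβ with rfl | rfl <;> rcases hγ with rfl | rfl <;> norm_num
  · have hb2 : β * β = 1 := by rcases hβ with rfl | rfl <;> norm_num
    have := Dvd.dvd.mul_left hd β
    rwa [show β * (x + β * y + γ * z) = y + β * x + β * γ * z by linear_combination y * hb2] at this

omit hq in
/-- Re-centring a vanishing pattern on its third entry: `q ∣ x + βy + γz ⇒ q ∣ z + γx + (γβ)y`. [folklore] -/
private theorem recenter₃_t5 {x y z : ℤ}
    (h : ∃ β γ : ℤ, (β = 1 ∨ β = -1) ∧ (γ = 1 ∨ γ = -1) ∧ (q : ℤ) ∣ x + β * y + γ * z) :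
    ∃ β γ : ℤ, (β = 1 ∨ β = -1) ∧ (γ = 1 ∨ γ = -1) ∧ (q : ℤ) ∣ z + β * x + γ * y := by
  obtain ⟨β, γ, hβ, hγ, hd⟩ := h
  refine ⟨γ, γ * β, hγ, ?_, ?_⟩
  · rcases hβ with rfl | rfl <;> rcases hγ with rfl | rfl <;> norm_num
  · have hc2 : γ * γ = 1 := by rcases hγ with rfl | rfl <;> norm_num
    have := Dvd.dvd.mul_left hd γ
    rwa [show γ * (x + β * y + γ * z) = z + γ * x + γ * β * y by linear_combination z * hc2] at this

/-- The heart of Lemma 1.5 (ii): for `a, b, c, d` with `a ≢ 0`, `b, c ≢ 0` and `b ≢ ±c`, `b ≢ ±d`, `c ≢ ±d (mod q)` (`q`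
prime), the three triples `(a, b, c)`, `(a, b, d)`, `(a, c, d)` through `a` cannot all have a vanishing sign pattern: with
(1.7) `a + βb + γc ≡ 0`, (1.8) `a + β'b + δd ≡ 0`, (1.9) `a + γ'c + δ'd ≡ 0` one gets `β' = −β` (else `c ≡ ±d`),
`γ' = −γ` (else `b ≡ ±d`), `δ' = −δ` (else `b ≡ ±c`, "`p₂ ≡ p₃ … a contradiction`"), and then the sum of the three is
`3a ≡ 0`, so `q = 3` — but modulo `3` two nonzero residues are always `≡` or `≡ −` each other ("since `Ĩ₀(3, 4)` is empty,
we have a contradiction"). [cite: Ikeda1980, Lemma 1.5 (ii) (proof, (1.7)–(1.9′))] -/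
private theorem false_of_three_patterns_t5 {a b c d : ℤ} (ha : ¬(q : ℤ) ∣ a) (hb : ¬(q : ℤ) ∣ b) (hc : ¬(q : ℤ) ∣ c)
    (hbc : ¬(q : ℤ) ∣ b - c) (hbc' : ¬(q : ℤ) ∣ b + c) (hbd : ¬(q : ℤ) ∣ b - d) (hbd' : ¬(q : ℤ) ∣ b + d)
    (hcd : ¬(q : ℤ) ∣ c - d) (hcd' : ¬(q : ℤ) ∣ c + d)
    (hu : ∃ β γ : ℤ, (β = 1 ∨ β = -1) ∧ (γ = 1 ∨ γ = -1) ∧ (q : ℤ) ∣ a + β * b + γ * c)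
    (hv : ∃ β γ : ℤ, (β = 1 ∨ β = -1) ∧ (γ = 1 ∨ γ = -1) ∧ (q : ℤ) ∣ a + β * b + γ * d)
    (hw : ∃ β γ : ℤ, (β = 1 ∨ β = -1) ∧ (γ = 1 ∨ γ = -1) ∧ (q : ℤ) ∣ a + β * c + γ * d) : False := by
  obtain ⟨β, γ, hβ, hγ, h7⟩ := hu
  obtain ⟨β', δ, hβ', hδ, h8⟩ := hv
  obtain ⟨γ', δ', hγ', hδ', h9⟩ := hw
  -- `q ∣ y − sz` with `s = ±1` contradicts `y ≢ ±z`
  have key : ∀ {y z s t : ℤ}, ¬(q : ℤ) ∣ y - z → ¬(q : ℤ) ∣ y + z → (s = 1 ∨ s = -1) → (t = 1 ∨ t = -1) →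
      (q : ℤ) ∣ s * y - t * z → False := by
    intro y z s t hyz hyz' hs ht hdvd
    rcases hs with rfl | rfl <;> rcases ht with rfl | rfl
    · exact hyz (dvd_congr_t5 hdvd (by ring))
    · exact hyz' (dvd_congr_t5 hdvd (by ring))
    · exact hyz' (dvd_neg.mp (dvd_congr_t5 hdvd (by ring)))
    · exact hyz (dvd_neg.mp (dvd_congr_t5 hdvd (by ring)))
  -- (1) `β' = −β`
  have e1 : β' = -β := by
    rcases hβ with rfl | rfl <;> rcases hβ' with rfl | rfl
    · exact (key hcd hcd' hγ hδ (dvd_congr_t5 (dvd_sub h7 h8) (by ring))).elim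
    · rfl
    · norm_num
    · exact (key hcd hcd' hγ hδ (dvd_congr_t5 (dvd_sub h7 h8) (by ring))).elim
  -- (2) `γ' = −γ`
  have e2 : γ' = -γ := by
    rcases hγ with rfl | rfl <;> rcases hγ' with rfl | rfl
    · exact (key hbd hbd' hβ hδ' (dvd_congr_t5 (dvd_sub h7 h9) (by ring))).elim
    · rfl
    · norm_num
    · exact (key hbd hbd' hβ hδ' (dvd_congr_t5 (dvd_sub h7 h9) (by ring))).elim
  -- (3) `δ' = −δ`
  have e3 : δ' = -δ := by
    subst e1 e2
    rcases hδ with rfl | rfl <;> rcases hδ' with rfl | rfl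
    · exact (key hbc hbc' hβ' hγ' (dvd_congr_t5 (dvd_sub h8 h9) (by ring))).elim
    · rfl
    · norm_num
    · exact (key hbc hbc' hβ' hγ' (dvd_congr_t5 (dvd_sub h8 h9) (by ring))).elim
  -- (4) the sum: `3a ≡ 0`, so `q = 3`
  subst e1 e2 e3
  have h3a : (q : ℤ) ∣ 3 * a := dvd_congr_t5 (dvd_add (dvd_add h7 h8) h9) (by ring)
  have hq3 : q = 3 := by
    rcases (Nat.prime_iff_prime_int.mp hq.out).dvd_or_dvd h3a with h3 | h3
    · exact (Nat.prime_dvd_prime_iff_eq hq.out Nat.prime_three).mp (by exact_mod_cast h3)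
    · exact absurd h3 ha
  -- (5) modulo `3`, `b ≡ ±c`
  subst hq3
  have c0 : ∀ {t : ℤ}, ¬((3 : ℕ) : ℤ) ∣ t → (t : ZMod 3) ≠ 0 := fun ht e ↦
    ht ((ZMod.intCast_zmod_eq_zero_iff_dvd _ _).mp e)
  have e3 := c0 hbc
  have e4 := c0 hbc'
  push_cast at e3 e4
  exact zmod_three_t5 _ _ (c0 hb) (c0 hc) e3 e4

/-- **LEMMA 1.5 (ii) (Ikeda 1980): for `(p₁, p₂, p₃, p₄) ∈ Ĩ₀(q, 4)` (`q` an odd prime),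
`Σ_{1≤l₁<l₂<l₃≤4}|A_q(p_{l₁}, p_{l₂}, p_{l₃})| ≤ 2`** — the total count of vanishing sign patterns over the four triples is
`0`, `1` or `2`: each triple contributes `0` or `1` (Lemma 1.4), and three triples — which always share one weight — cannot
all contribute (`false_of_three_patterns_t5`, the source's (1.7)–(1.9′) argument, applied with the shared weight as centre).
[cite: Ikeda1980, Lemma 1.5 (ii)] -/
theorem IsIkedaWeights.triplePatternCount_four_le_two (hq2 : q ≠ 2) {ω : Fin 4 → ℤ} (hω : IsIkedaWeights q ω) :
    ((if (q : ℤ) ∣ ω 0 + ω 1 + ω 2 then (1 : ℝ) else 0) + (if (q : ℤ) ∣ ω 0 + ω 1 - ω 2 then (1 : ℝ) else 0) + (if (q : ℤ) ∣ ω 0 - ω 1 + ω 2 then (1 : ℝ) else 0) + (if (q : ℤ) ∣ ω 0 - ω 1 - ω 2 then (1 : ℝ) else 0) +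
          ((if (q : ℤ) ∣ ω 0 + ω 1 + ω 3 then (1 : ℝ) else 0) + (if (q : ℤ) ∣ ω 0 + ω 1 - ω 3 then (1 : ℝ) else 0) + (if (q : ℤ) ∣ ω 0 - ω 1 + ω 3 then (1 : ℝ) else 0) + (if (q : ℤ) ∣ ω 0 - ω 1 - ω 3 then (1 : ℝ) else 0)) +
          ((if (q : ℤ) ∣ ω 0 + ω 2 + ω 3 then (1 : ℝ) else 0) + (if (q : ℤ) ∣ ω 0 + ω 2 - ω 3 then (1 : ℝ) else 0) + (if (q : ℤ) ∣ ω 0 - ω 2 + ω 3 then (1 : ℝ) else 0) + (if (q : ℤ) ∣ ω 0 - ω 2 - ω 3 then (1 : ℝ) else 0)) +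
          ((if (q : ℤ) ∣ ω 1 + ω 2 + ω 3 then (1 : ℝ) else 0) + (if (q : ℤ) ∣ ω 1 + ω 2 - ω 3 then (1 : ℝ) else 0) + (if (q : ℤ) ∣ ω 1 - ω 2 + ω 3 then (1 : ℝ) else 0) + (if (q : ℤ) ∣ ω 1 - ω 2 - ω 3 then (1 : ℝ) else 0))) = 0 ∨
      ((if (q : ℤ) ∣ ω 0 + ω 1 + ω 2 then (1 : ℝ) else 0) + (if (q : ℤ) ∣ ω 0 + ω 1 - ω 2 then (1 : ℝ) else 0) + (if (q : ℤ) ∣ ω 0 - ω 1 + ω 2 then (1 : ℝ) else 0) + (if (q : ℤ) ∣ ω 0 - ω 1 - ω 2 then (1 : ℝ) else 0) +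
          ((if (q : ℤ) ∣ ω 0 + ω 1 + ω 3 then (1 : ℝ) else 0) + (if (q : ℤ) ∣ ω 0 + ω 1 - ω 3 then (1 : ℝ) else 0) + (if (q : ℤ) ∣ ω 0 - ω 1 + ω 3 then (1 : ℝ) else 0) + (if (q : ℤ) ∣ ω 0 - ω 1 - ω 3 then (1 : ℝ) else 0)) +
          ((if (q : ℤ) ∣ ω 0 + ω 2 + ω 3 then (1 : ℝ) else 0) + (if (q : ℤ) ∣ ω 0 + ω 2 - ω 3 then (1 : ℝ) else 0) + (if (q : ℤ) ∣ ω 0 - ω 2 + ω 3 then (1 : ℝ) else 0) + (if (q : ℤ) ∣ ω 0 - ω 2 - ω 3 then (1 : ℝ) else 0)) +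
          ((if (q : ℤ) ∣ ω 1 + ω 2 + ω 3 then (1 : ℝ) else 0) + (if (q : ℤ) ∣ ω 1 + ω 2 - ω 3 then (1 : ℝ) else 0) + (if (q : ℤ) ∣ ω 1 - ω 2 + ω 3 then (1 : ℝ) else 0) + (if (q : ℤ) ∣ ω 1 - ω 2 - ω 3 then (1 : ℝ) else 0))) = 1 ∨
      ((if (q : ℤ) ∣ ω 0 + ω 1 + ω 2 then (1 : ℝ) else 0) + (if (q : ℤ) ∣ ω 0 + ω 1 - ω 2 then (1 : ℝ) else 0) + (if (q : ℤ) ∣ ω 0 - ω 1 + ω 2 then (1 : ℝ) else 0) + (if (q : ℤ) ∣ ω 0 - ω 1 - ω 2 then (1 : ℝ) else 0) +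
          ((if (q : ℤ) ∣ ω 0 + ω 1 + ω 3 then (1 : ℝ) else 0) + (if (q : ℤ) ∣ ω 0 + ω 1 - ω 3 then (1 : ℝ) else 0) + (if (q : ℤ) ∣ ω 0 - ω 1 + ω 3 then (1 : ℝ) else 0) + (if (q : ℤ) ∣ ω 0 - ω 1 - ω 3 then (1 : ℝ) else 0)) +
          ((if (q : ℤ) ∣ ω 0 + ω 2 + ω 3 then (1 : ℝ) else 0) + (if (q : ℤ) ∣ ω 0 + ω 2 - ω 3 then (1 : ℝ) else 0) + (if (q : ℤ) ∣ ω 0 - ω 2 + ω 3 then (1 : ℝ) else 0) + (if (q : ℤ) ∣ ω 0 - ω 2 - ω 3 then (1 : ℝ) else 0)) +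
          ((if (q : ℤ) ∣ ω 1 + ω 2 + ω 3 then (1 : ℝ) else 0) + (if (q : ℤ) ∣ ω 1 + ω 2 - ω 3 then (1 : ℝ) else 0) + (if (q : ℤ) ∣ ω 1 - ω 2 + ω 3 then (1 : ℝ) else 0) + (if (q : ℤ) ∣ ω 1 - ω 2 - ω 3 then (1 : ℝ) else 0))) = 2 := by
  have hn : ∀ i, ¬(q : ℤ) ∣ ω i := hω.not_dvd
  have hs : ∀ i j, i ≠ j → ¬(q : ℤ) ∣ ω i - ω j := hω.not_dvd_sub
  have ha : ∀ i j, i ≠ j → ¬(q : ℤ) ∣ ω i + ω j := hω.not_dvd_add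
  have aux := fun {a b c : ℤ} (ha : ¬(q : ℤ) ∣ a) (hb : ¬(q : ℤ) ∣ b) (hc : ¬(q : ℤ) ∣ c) ↦
    Literature.Analysis.InnerProduct.signPatternCount_three_eq_zero_or_one hq2 ha hb hc
  have h4 := aux (hn 0) (hn 1) (hn 2)
  have h3 := aux (hn 0) (hn 1) (hn 3)
  have h2 := aux (hn 0) (hn 2) (hn 3)
  have h1 := aux (hn 1) (hn 2) (hn 3)
  -- the four configurations of three triples, by their common weight `ω 0`, `ω 1`, `ω 2`, `ω 3`
  have c0 : (if (q : ℤ) ∣ ω 0 + ω 1 + ω 2 then (1 : ℝ) else 0) + (if (q : ℤ) ∣ ω 0 + ω 1 - ω 2 then (1 : ℝ) else 0) + (if (q : ℤ) ∣ ω 0 - ω 1 + ω 2 then (1 : ℝ) else 0) + (if (q : ℤ) ∣ ω 0 - ω 1 - ω 2 then (1 : ℝ) else 0) = 1 → (if (q : ℤ) ∣ ω 0 + ω 1 + ω 3 then (1 : ℝ) else 0) + (if (q : ℤ) ∣ ω 0 + ω 1 - ω 3 then (1 : ℝ) else 0) + (if (q : ℤ) ∣ ω 0 - ω 1 + ω 3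 then (1 : ℝ) else 0) + (if (q : ℤ) ∣ ω 0 - ω 1 - ω 3 then (1 : ℝ) else 0) = 1 → (if (q : ℤ) ∣ ω 0 + ω 2 + ω 3 then (1 : ℝ) else 0) + (if (q : ℤ) ∣ ω 0 + ω 2 - ω 3 then (1 : ℝ) else 0) + (if (q : ℤ) ∣ ω 0 - ω 2 + ω 3 then (1 : ℝ) else 0) + (if (q : ℤ) ∣ ω 0 - ω 2 - ω 3 then (1 : ℝ) else 0) = 1 → False := fun e4 e3 e2 ↦
    false_of_three_patterns_t5 (hn 0) (hn 1) (hn 2) (hs 1 2 (by decide)) (ha 1 2 (by decide)) (hs 1 3 (by decide))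
      (ha 1 3 (by decide)) (hs 2 3 (by decide)) (ha 2 3 (by decide))
      (exists_signs_of_count_ne_zero_t5 (by rw [e4]; norm_num)) (exists_signs_of_count_ne_zero_t5 (by rw [e3]; norm_num))
      (exists_signs_of_count_ne_zero_t5 (by rw [e2]; norm_num))
  have c1 : (if (q : ℤ) ∣ ω 0 + ω 1 + ω 2 then (1 : ℝ) else 0) + (if (q : ℤ) ∣ ω 0 + ω 1 - ω 2 then (1 : ℝ) else 0) + (if (q : ℤ) ∣ ω 0 - ω 1 + ω 2 then (1 : ℝ) else 0) + (if (q : ℤ) ∣ ω 0 - ω 1 - ω 2 then (1 : ℝ) else 0) = 1 → (if (q : ℤ) ∣ ω 0 + ω 1 + ω 3 then (1 : ℝ) else 0) + (if (q : ℤ) ∣ ω 0 + ω 1 - ω 3 then (1 : ℝ) else 0) + (if (q : ℤ) ∣ ω 0 - ω 1 + ω 3 then (1 : ℝ) else 0) + (if (q : ℤ) ∣ ω 0 - ω 1 - ω 3 then (1 : ℝ) else 0) = 1 → (if (q : ℤ) ∣ ω 1 + ω 2 + ω 3 then (1 : ℝ) else 0) + (if (q : ℤ) ∣ ω 1 + ω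 2 - ω 3 then (1 : ℝ) else 0) + (if (q : ℤ) ∣ ω 1 - ω 2 + ω 3 then (1 : ℝ) else 0) + (if (q : ℤ) ∣ ω 1 - ω 2 - ω 3 then (1 : ℝ) else 0) = 1 → False := fun e4 e3 e1 ↦
    false_of_three_patterns_t5 (hn 1) (hn 0) (hn 2) (hs 0 2 (by decide)) (ha 0 2 (by decide)) (hs 0 3 (by decide))
      (ha 0 3 (by decide)) (hs 2 3 (by decide)) (ha 2 3 (by decide))
      (recenter₂_t5 (exists_signs_of_count_ne_zero_t5 (by rw [e4]; norm_num)))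
      (recenter₂_t5 (exists_signs_of_count_ne_zero_t5 (by rw [e3]; norm_num)))
      (exists_signs_of_count_ne_zero_t5 (by rw [e1]; norm_num))
  have c2 : (if (q : ℤ) ∣ ω 0 + ω 1 + ω 2 then (1 : ℝ) else 0) + (if (q : ℤ) ∣ ω 0 + ω 1 - ω 2 then (1 : ℝ) else 0) + (if (q : ℤ) ∣ ω 0 - ω 1 + ω 2 then (1 : ℝ) else 0) + (if (q : ℤ) ∣ ω 0 - ω 1 - ω 2 then (1 : ℝ) else 0) = 1 → (if (q : ℤ) ∣ ω 0 + ω 2 + ω 3 then (1 : ℝ) else 0) + (if (q : ℤ) ∣ ω 0 + ω 2 - ω 3 then (1 : ℝ) else 0) + (if (q : ℤ) ∣ ω 0 - ω 2 + ω 3 then (1 : ℝ) else 0) + (if (q : ℤ) ∣ ω 0 - ω 2 - ω 3 then (1 : ℝ) else 0) = 1 → (if (q : ℤ) ∣ ω 1 + ω 2 + ω 3 then (1 : ℝ) else 0) + (if (q : ℤ) ∣ ω 1 + ω 2 - ω 3 then (1 : ℝ) else 0) + (if (q : ℤ) ∣ ω 1 - ω 2 + ω 3 then (1 : ℝ) else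 0) + (if (q : ℤ) ∣ ω 1 - ω 2 - ω 3 then (1 : ℝ) else 0) = 1 → False := fun e4 e2 e1 ↦
    false_of_three_patterns_t5 (hn 2) (hn 0) (hn 1) (hs 0 1 (by decide)) (ha 0 1 (by decide)) (hs 0 3 (by decide))
      (ha 0 3 (by decide)) (hs 1 3 (by decide)) (ha 1 3 (by decide))
      (recenter₃_t5 (exists_signs_of_count_ne_zero_t5 (by rw [e4]; norm_num)))
      (recenter₂_t5 (exists_signs_of_count_ne_zero_t5 (by rw [e2]; norm_num)))
      (recenter₂_t5 (exists_signs_of_count_ne_zero_t5 (by rw [e1]; norm_num)))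
  have c3 : (if (q : ℤ) ∣ ω 0 + ω 1 + ω 3 then (1 : ℝ) else 0) + (if (q : ℤ) ∣ ω 0 + ω 1 - ω 3 then (1 : ℝ) else 0) + (if (q : ℤ) ∣ ω 0 - ω 1 + ω 3 then (1 : ℝ) else 0) + (if (q : ℤ) ∣ ω 0 - ω 1 - ω 3 then (1 : ℝ) else 0) = 1 → (if (q : ℤ) ∣ ω 0 + ω 2 + ω 3 then (1 : ℝ) else 0) + (if (q : ℤ) ∣ ω 0 + ω 2 - ω 3 then (1 : ℝ) else 0) + (if (q : ℤ) ∣ ω 0 - ω 2 + ω 3 then (1 : ℝ) else 0) + (if (q : ℤ) ∣ ω 0 - ω 2 - ω 3 then (1 : ℝ) else 0) = 1 → (if (q : ℤ) ∣ ω 1 + ω 2 + ω 3 then (1 : ℝ) else 0) + (if (q : ℤ) ∣ ω 1 + ω 2 - ω 3 then (1 : ℝ) else 0) + (if (q : ℤ) ∣ ω 1 - ω 2 + ω 3 then (1 : ℝ) else 0) + (if (q : ℤ) ∣ ω 1 - ω 2 - ω 3 then (1 : ℝ) else 0) = 1 → False := fun e3 e2 e1 ↦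
    false_of_three_patterns_t5 (hn 3) (hn 0) (hn 1) (hs 0 1 (by decide)) (ha 0 1 (by decide)) (hs 0 2 (by decide))
      (ha 0 2 (by decide)) (hs 1 2 (by decide)) (ha 1 2 (by decide))
      (recenter₃_t5 (exists_signs_of_count_ne_zero_t5 (by rw [e3]; norm_num)))
      (recenter₃_t5 (exists_signs_of_count_ne_zero_t5 (by rw [e2]; norm_num)))
      (recenter₃_t5 (exists_signs_of_count_ne_zero_t5 (by rw [e1]; norm_num)))
  have hsum : ((if (q : ℤ) ∣ ω 0 + ω 1 + ω 2 then (1 : ℝ) else 0) + (if (q : ℤ) ∣ ω 0 + ω 1 - ω 2 then (1 : ℝ) else 0) + (if (q : ℤ) ∣ ω 0 - ω 1 + ω 2 then (1 : ℝ) else 0) + (if (q : ℤ) ∣ ω 0 - ω 1 - ω 2 then (1 : ℝ) else 0) +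
          ((if (q : ℤ) ∣ ω 0 + ω 1 + ω 3 then (1 : ℝ) else 0) + (if (q : ℤ) ∣ ω 0 + ω 1 - ω 3 then (1 : ℝ) else 0) + (if (q : ℤ) ∣ ω 0 - ω 1 + ω 3 then (1 : ℝ) else 0) + (if (q : ℤ) ∣ ω 0 - ω 1 - ω 3 then (1 : ℝ) else 0)) +
          ((if (q : ℤ) ∣ ω 0 + ω 2 + ω 3 then (1 : ℝ) else 0) + (if (q : ℤ) ∣ ω 0 + ω 2 - ω 3 then (1 : ℝ) else 0) + (if (q : ℤ) ∣ ω 0 - ω 2 + ω 3 then (1 : ℝ) else 0) + (if (q : ℤ) ∣ ω 0 - ω 2 - ω 3 then (1 : ℝ) else 0)) +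
          ((if (q : ℤ) ∣ ω 1 + ω 2 + ω 3 then (1 : ℝ) else 0) + (if (q : ℤ) ∣ ω 1 + ω 2 - ω 3 then (1 : ℝ) else 0) + (if (q : ℤ) ∣ ω 1 - ω 2 + ω 3 then (1 : ℝ) else 0) + (if (q : ℤ) ∣ ω 1 - ω 2 - ω 3 then (1 : ℝ) else 0))) =
      ((if (q : ℤ) ∣ ω 0 + ω 1 + ω 2 then (1 : ℝ) else 0) + (if (q : ℤ) ∣ ω 0 + ω 1 - ω 2 then (1 : ℝ) else 0) + (if (q : ℤ) ∣ ω 0 - ω 1 + ω 2 then (1 : ℝ) else 0) + (if (q : ℤ) ∣ ω 0 - ω 1 - ω 2 then (1 : ℝ) else 0)) + ((if (q : ℤ) ∣ ω 0 + ω 1 + ω 3 then (1 : ℝ) else 0) + (if (q : ℤ) ∣ ω 0 + ω 1 - ω 3 then (1 : ℝ) else 0) + (if (q : ℤ) ∣ ω 0 - ω 1 + ω 3 then (1 : ℝ) else 0) + (if (q : ℤ) ∣ ω 0 - ω 1 - ω 3 then (1 : ℝ) else 0)) + ((if (q : ℤ) ∣ ω 0 + ω 2 + ω 3 then (1 : ℝ)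 else 0) + (if (q : ℤ) ∣ ω 0 + ω 2 - ω 3 then (1 : ℝ) else 0) + (if (q : ℤ) ∣ ω 0 - ω 2 + ω 3 then (1 : ℝ) else 0) + (if (q : ℤ) ∣ ω 0 - ω 2 - ω 3 then (1 : ℝ) else 0)) + ((if (q : ℤ) ∣ ω 1 + ω 2 + ω 3 then (1 : ℝ) else 0) + (if (q : ℤ) ∣ ω 1 + ω 2 - ω 3 then (1 : ℝ) else 0) + (if (q : ℤ) ∣ ω 1 - ω 2 + ω 3 then (1 : ℝ) else 0) + (if (q : ℤ) ∣ ω 1 - ω 2 - ω 3 then (1 : ℝ) else 0)) := by ring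
  rw [hsum]
  rcases h4 with e4 | e4 <;> rcases h3 with e3 | e3 <;> rcases h2 with e2 | e2 <;> rcases h1 with e1 | e1 <;>
    rw [e4, e3, e2, e1] <;> norm_num
  · exact c3 e3 e2 e1
  · exact c2 e4 e2 e1
  · exact c1 e4 e3 e1
  · exact c0 e4 e3 e2
  · exact c0 e4 e3 e2

/-! ### Proposition 1.6 as an equivalence and Proposition 1.9 (ii) -/

/-- **PROPOSITION 1.6 AS AN EQUIVALENCE: for `ω, ω' ∈ Ĩ₀(q, 4)`, `Ψ_{q,4}(ω) = Ψ_{q,4}(ω')` if and only if (i)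
`Σ|A_q(ω_{i₁},ω_{i₂},ω_{i₃})| = Σ|A_q(ω'_{i₁},ω'_{i₂},ω'_{i₃})|` and (ii) `|A_q(ω)| = |A_q(ω')|`** (the coefficients of `z⁵` and `z⁴`
in `Ψ_{q,4}` are `56 − 2qΣ|A_q(triples)|` and `2q|A_q| + 6q − 70`). [cite: Ikeda1980, Proposition 1.6] -/
theorem IsIkedaWeights.ikedaPolynomial_fin_four_eq_iff {ω ω' : Fin 4 → ℤ} (hω : IsIkedaWeights q ω)
    (hω' : IsIkedaWeights q ω') :
    ikedaPolynomial q ω = ikedaPolynomial q ω' ↔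
      ((if (q : ℤ) ∣ ω 0 + ω 1 + ω 2 then (1 : ℝ) else 0) + (if (q : ℤ) ∣ ω 0 + ω 1 - ω 2 then (1 : ℝ) else 0) + (if (q : ℤ) ∣ ω 0 - ω 1 + ω 2 then (1 : ℝ) else 0) + (if (q : ℤ) ∣ ω 0 - ω 1 - ω 2 then (1 : ℝ) else 0) +
          ((if (q : ℤ) ∣ ω 0 + ω 1 + ω 3 then (1 : ℝ) else 0) + (if (q : ℤ) ∣ ω 0 + ω 1 - ω 3 then (1 : ℝ) else 0) + (if (q : ℤ) ∣ ω 0 - ω 1 + ω 3 then (1 : ℝ) else 0) + (if (q : ℤ) ∣ ω 0 - ω 1 - ω 3 then (1 : ℝ) else 0)) +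
          ((if (q : ℤ) ∣ ω 0 + ω 2 + ω 3 then (1 : ℝ) else 0) + (if (q : ℤ) ∣ ω 0 + ω 2 - ω 3 then (1 : ℝ) else 0) + (if (q : ℤ) ∣ ω 0 - ω 2 + ω 3 then (1 : ℝ) else 0) + (if (q : ℤ) ∣ ω 0 - ω 2 - ω 3 then (1 : ℝ) else 0)) +
          ((if (q : ℤ) ∣ ω 1 + ω 2 + ω 3 then (1 : ℝ) else 0) + (if (q : ℤ) ∣ ω 1 + ω 2 - ω 3 then (1 : ℝ) else 0) + (if (q : ℤ) ∣ ω 1 - ω 2 + ω 3 then (1 : ℝ) else 0) + (if (q : ℤ) ∣ ω 1 - ω 2 - ω 3 then (1 : ℝ) else 0))) =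
        ((if (q : ℤ) ∣ ω' 0 + ω' 1 + ω' 2 then (1 : ℝ) else 0) + (if (q : ℤ) ∣ ω' 0 + ω' 1 - ω' 2 then (1 : ℝ) else 0) + (if (q : ℤ) ∣ ω' 0 - ω' 1 + ω' 2 then (1 : ℝ) else 0) + (if (q : ℤ) ∣ ω' 0 - ω' 1 - ω' 2 then (1 : ℝ) else 0) +
          ((if (q : ℤ) ∣ ω' 0 + ω' 1 + ω' 3 then (1 : ℝ) else 0) + (if (q : ℤ) ∣ ω' 0 + ω' 1 - ω' 3 then (1 : ℝ) else 0) + (if (q : ℤ) ∣ ω' 0 - ω' 1 + ω' 3 then (1 : ℝ) else 0) + (if (q : ℤ) ∣ ω' 0 - ω' 1 - ω' 3 then (1 : ℝ) else 0)) +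
          ((if (q : ℤ) ∣ ω' 0 + ω' 2 + ω' 3 then (1 : ℝ) else 0) + (if (q : ℤ) ∣ ω' 0 + ω' 2 - ω' 3 then (1 : ℝ) else 0) + (if (q : ℤ) ∣ ω' 0 - ω' 2 + ω' 3 then (1 : ℝ) else 0) + (if (q : ℤ) ∣ ω' 0 - ω' 2 - ω' 3 then (1 : ℝ) else 0)) +
          ((if (q : ℤ) ∣ ω' 1 + ω' 2 + ω' 3 then (1 : ℝ) else 0) + (if (q : ℤ) ∣ ω' 1 + ω' 2 - ω' 3 then (1 : ℝ) else 0) + (if (q : ℤ) ∣ ω' 1 - ω' 2 + ω' 3 then (1 : ℝ) else 0) + (if (q : ℤ) ∣ ω' 1 - ω' 2 - ω' 3 then (1 : ℝ) else 0))) ∧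
      ((if (q : ℤ) ∣ ω 0 + ω 1 + ω 2 + ω 3 then (1 : ℝ) else 0) + (if (q : ℤ) ∣ ω 0 + ω 1 + ω 2 - ω 3 then (1 : ℝ) else 0) +
          (if (q : ℤ) ∣ ω 0 + ω 1 - ω 2 + ω 3 then (1 : ℝ) else 0) + (if (q : ℤ) ∣ ω 0 + ω 1 - ω 2 - ω 3 then (1 : ℝ) else 0) +
          (if (q : ℤ) ∣ ω 0 - ω 1 + ω 2 + ω 3 then (1 : ℝ) else 0) + (if (q : ℤ) ∣ ω 0 - ω 1 + ω 2 - ω 3 then (1 : ℝ) else 0) +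
          (if (q : ℤ) ∣ ω 0 - ω 1 - ω 2 + ω 3 then (1 : ℝ) else 0) + (if (q : ℤ) ∣ ω 0 - ω 1 - ω 2 - ω 3 then (1 : ℝ) else 0)) =
        ((if (q : ℤ) ∣ ω' 0 + ω' 1 + ω' 2 + ω' 3 then (1 : ℝ) else 0) + (if (q : ℤ) ∣ ω' 0 + ω' 1 + ω' 2 - ω' 3 then (1 : ℝ) else 0) +
          (if (q : ℤ) ∣ ω' 0 + ω' 1 - ω' 2 + ω' 3 then (1 : ℝ) else 0) + (if (q : ℤ) ∣ ω' 0 + ω' 1 - ω' 2 - ω' 3 then (1 : ℝ) else 0) +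
          (if (q : ℤ) ∣ ω' 0 - ω' 1 + ω' 2 + ω' 3 then (1 : ℝ) else 0) + (if (q : ℤ) ∣ ω' 0 - ω' 1 + ω' 2 - ω' 3 then (1 : ℝ) else 0) +
          (if (q : ℤ) ∣ ω' 0 - ω' 1 - ω' 2 + ω' 3 then (1 : ℝ) else 0) + (if (q : ℤ) ∣ ω' 0 - ω' 1 - ω' 2 - ω' 3 then (1 : ℝ) else 0)) := by
  refine ⟨fun h ↦ ⟨?_, ?_⟩, fun h ↦ hω.ikedaPolynomial_fin_four_eq hω' h.1 h.2⟩
  · have hq0 : (q : ℝ) ≠ 0 := Nat.cast_ne_zero.mpr hq.out.ne_zero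
    have hc := congrArg (fun P : ℝ[X] ↦ P.coeff 5) h
    simp only [hω.ikedaPolynomial_fin_four, hω'.ikedaPolynomial_fin_four, Polynomial.coeff_add, Polynomial.coeff_C_mul,
      Polynomial.coeff_X_pow, Polynomial.coeff_X, Polynomial.coeff_one, Nat.reduceEqDiff, reduceIte, mul_one, mul_zero,
      add_zero, zero_add] at hc
    exact mul_left_cancel₀ hq0 (by linear_combination -hc / 2)
  · have hq0 : (q : ℝ) ≠ 0 := Nat.cast_ne_zero.mpr hq.out.ne_zero
    have hc := congrArg (fun P : ℝ[X] ↦ P.coeff 4) h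
    simp only [hω.ikedaPolynomial_fin_four, hω'.ikedaPolynomial_fin_four, Polynomial.coeff_add, Polynomial.coeff_C_mul,
      Polynomial.coeff_X_pow, Polynomial.coeff_X, Polynomial.coeff_one, Nat.reduceEqDiff, reduceIte, mul_one, mul_zero,
      add_zero, zero_add] at hc
    exact mul_left_cancel₀ hq0 (by linear_combination hc / 2)

/-- **PROPOSITION 1.9 (ii) (Ikeda 1980): `|J(q, 4)| ≤ 6`** — the set `J(q, 4) = Ψ̃_{q,4}(𝓛₀(q, 4))` of values of `Ψ_{q,4}`
on `Ĩ₀(q, 4)` has at most six elements (`q` an odd prime): by Proposition 1.6 the value is determined by the pair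
(`Σ|A_q(triples)|`, `|A_q(ω)|`) `∈ {0, 1, 2} × {0, 1}` (Lemma 1.5). [cite: Ikeda1980, Proposition 1.9 (ii), Lemma 1.5,
Proposition 1.6] -/
theorem ncard_ikedaPolynomial_fin_four_le_six (hq2 : q ≠ 2) :
    {P : ℝ[X] | ∃ ω : Fin 4 → ℤ, IsIkedaWeights q ω ∧ ikedaPolynomial q ω = P}.ncard ≤ 6 := by
  classical
  let f : ℕ × ℕ → ℝ[X] := fun st ↦
    Polynomial.C ((q : ℝ) - 1) * (X ^ 8 + 1) + Polynomial.C 8 * (X ^ 7 + X) +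
      Polynomial.C (4 * (q : ℝ) - 28) * (X ^ 6 + X ^ 2) +
      Polynomial.C (56 - 2 * (q : ℝ) * (st.1 : ℝ)) * (X ^ 5 + X ^ 3) +
      Polynomial.C (2 * (q : ℝ) * (st.2 : ℝ) + 6 * (q : ℝ) - 70) * X ^ 4
  have hsub : {P : ℝ[X] | ∃ ω : Fin 4 → ℤ, IsIkedaWeights q ω ∧ ikedaPolynomial q ω = P} ⊆
      ↑((Finset.range 3 ×ˢ Finset.range 2).image f) := by
    rintro P ⟨ω, hω, rfl⟩
    obtain ⟨s, hs, hS⟩ : ∃ s : ℕ, s < 3 ∧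
        ((if (q : ℤ) ∣ ω 0 + ω 1 + ω 2 then (1 : ℝ) else 0) + (if (q : ℤ) ∣ ω 0 + ω 1 - ω 2 then (1 : ℝ) else 0) + (if (q : ℤ) ∣ ω 0 - ω 1 + ω 2 then (1 : ℝ) else 0) + (if (q : ℤ) ∣ ω 0 - ω 1 - ω 2 then (1 : ℝ) else 0) +
          ((if (q : ℤ) ∣ ω 0 + ω 1 + ω 3 then (1 : ℝ) else 0) + (if (q : ℤ) ∣ ω 0 + ω 1 - ω 3 then (1 : ℝ) else 0) + (if (q : ℤ) ∣ ω 0 - ω 1 + ω 3 then (1 : ℝ) else 0) + (if (q : ℤ) ∣ ω 0 - ω 1 - ω 3 then (1 : ℝ) else 0)) +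
          ((if (q : ℤ) ∣ ω 0 + ω 2 + ω 3 then (1 : ℝ) else 0) + (if (q : ℤ) ∣ ω 0 + ω 2 - ω 3 then (1 : ℝ) else 0) + (if (q : ℤ) ∣ ω 0 - ω 2 + ω 3 then (1 : ℝ) else 0) + (if (q : ℤ) ∣ ω 0 - ω 2 - ω 3 then (1 : ℝ) else 0)) +
          ((if (q : ℤ) ∣ ω 1 + ω 2 + ω 3 then (1 : ℝ) else 0) + (if (q : ℤ) ∣ ω 1 + ω 2 - ω 3 then (1 : ℝ) else 0) + (if (q : ℤ) ∣ ω 1 - ω 2 + ω 3 then (1 : ℝ) else 0) + (if (q : ℤ) ∣ ω 1 - ω 2 - ω 3 then (1 : ℝ) else 0))) = (s : ℝ) := by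
      rcases hω.triplePatternCount_four_le_two hq2 with h | h | h
      · exact ⟨0, by norm_num, by rw [h]; norm_num⟩
      · exact ⟨1, by norm_num, by rw [h]; norm_num⟩
      · exact ⟨2, by norm_num, by rw [h]; norm_num⟩
    obtain ⟨t, ht, hN⟩ : ∃ t : ℕ, t < 2 ∧
        ((if (q : ℤ) ∣ ω 0 + ω 1 + ω 2 + ω 3 then (1 : ℝ) else 0) + (if (q : ℤ) ∣ ω 0 + ω 1 + ω 2 - ω 3 then (1 : ℝ) else 0) +
          (if (q : ℤ) ∣ ω 0 + ω 1 - ω 2 + ω 3 then (1 : ℝ) else 0) + (if (q : ℤ) ∣ ω 0 + ω 1 - ω 2 - ω 3 then (1 : ℝ) else 0) +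
          (if (q : ℤ) ∣ ω 0 - ω 1 + ω 2 + ω 3 then (1 : ℝ) else 0) + (if (q : ℤ) ∣ ω 0 - ω 1 + ω 2 - ω 3 then (1 : ℝ) else 0) +
          (if (q : ℤ) ∣ ω 0 - ω 1 - ω 2 + ω 3 then (1 : ℝ) else 0) + (if (q : ℤ) ∣ ω 0 - ω 1 - ω 2 - ω 3 then (1 : ℝ) else 0)) = (t : ℝ) := by
      rcases hω.signPatternCount_four_eq_zero_or_one hq2 with h | h
      · exact ⟨0, by norm_num, by rw [h]; norm_num⟩
      · exact ⟨1, by norm_num, by rw [h]; norm_num⟩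
    rw [Finset.coe_image]
    refine ⟨(s, t), by simp [hs, ht], ?_⟩
    rw [hω.ikedaPolynomial_fin_four, hS, hN]
  calc {P : ℝ[X] | ∃ ω : Fin 4 → ℤ, IsIkedaWeights q ω ∧ ikedaPolynomial q ω = P}.ncard
      ≤ (↑((Finset.range 3 ×ˢ Finset.range 2).image f) : Set ℝ[X]).ncard :=
        Set.ncard_le_ncard hsub (Finset.finite_toSet _)
    _ = ((Finset.range 3 ×ˢ Finset.range 2).image f).card := Set.ncard_coe_finset _
    _ ≤ (Finset.range 3 ×ˢ Finset.range 2).card := Finset.card_image_le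
    _ = 6 := by simp

end LemmaOneFour

end Literature.Analysis.InnerProduct
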